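import Mathlib

/-!
# PercRepro — C-025 Theorem H: `(p, q) = (4, 2)` on every simple matroid — the combinatorial core (p2, gen 5)

`proofs/MINE2-RLS.md` §8 (mine-2, gen 6).  For a finite SIMPLE matroid `M` (no loops, no parallel pairs) let
`U := {A ⊆ E : ρ(A) = 4, ρ(E ∖ A) = 2}` and `Y := {S ⊆ E : ρ(S) = 3}`.  Theorem H is `4·#U ≤ 3·#Y`
(i.e. `Φ(4,2)·#U ≤ #Y` with `Φ(4,2) = 4/3`).  The proof charges everything to the LINES of `M` (rank-2 flats):

* Step 1 — rank-3 sets from lines: for a line `L`, `B ⊆ L` with `|B| ≥ 2` and `x ∉ L`, the set `B ∪ {x}` has rank 3;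
  with `|B| ≥ 3` the triple `(L, B, x)` is recovered from the set (two lines sharing two points coincide), and
  with `|B| = 2` every rank-3 set has at most three such representations (the choice of `x`).  Hence
  `3·#Y ≥ Σ_L |E ∖ L|·(3·a₃(L) + C(|L|, 2))`, `a₃(L) := #{B ⊆ L : |B| ≥ 3}`.
* Step 2 — the `U` side: `A ↦ (cl(E ∖ A), E ∖ A)` injects `U` into `⊔_L U_L`, `U_L := {B ⊆ L : |B| ≥ 2, ρ(E ∖ B) = 4}`.
* Step 3 — per line, with `n' := |E ∖ L|`: `4·#U_L ≤ n'·(3·a₃(L) + C(|L|,2))`.  Here the crude bounds suffice: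
  `ρ(E ∖ B) = 4` forces `|E ∖ B| ≥ 4` and `ρ(E ∖ L) + ρ(L ∖ B) ≥ 4`, so `n' ≤ 1` gives `U_L = ∅`, `n' = 2` excludes
  `B = L` and `B = L ∖ {pt}`, `n' = 3` excludes `B = L`; the three binomial inequalities
  `6·C(ℓ,2) + 5ℓ + 1 ≤ 5·2^ℓ`, `2·C(ℓ,2) ≤ 2^ℓ + ℓ + 1` close the cases (this replaces §8's type analysis by
  hyperplanes and skew pairs — the finer bounds there are not needed for the inequality).

All counting is done on `Finset`s of the finite ground set; the `Set.ncard` / `phiK` spelling of `C025` is the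
companion file `RankLevelSetH.lean`.  Imports Mathlib only.
-/

namespace PercRepro

namespace ThmH

open Finset

variable {α : Type*} [DecidableEq α]

/-- A finite matroid is SIMPLE if every two distinct points of the ground set have rank 2 (no loops, no parallel
pairs, once the ground set has at least two points). -/
def Simple (M : Matroid α) : Prop := ∀ e ∈ M.E, ∀ f ∈ M.E, e ≠ f → M.eRk {e, f} = 2

/-- `2n ≤ 2^n + 1`. -/
theorem two_mul_le_two_pow_add_one (n : ℕ) : 2 * n ≤ 2 ^ n + 1 := by
  induction n with
  | zero => decide
  | succ n ih =>
    rcases Nat.eq_zero_or_pos n with rfl | hn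
    · decide
    · have h2 : 2 ≤ 2 ^ n := by
        calc 2 = 2 ^ 1 := by norm_num
          _ ≤ 2 ^ n := Nat.pow_le_pow_right (by norm_num) hn
      rw [pow_succ]
      omega

/-- `C(n+1, 2) = n + C(n, 2)`. -/
theorem choose_two_succ (n : ℕ) : (n + 1).choose 2 = n + n.choose 2 := by
  rw [Nat.choose_succ_succ' n 1, Nat.choose_one_right]

/-- The numeric inequality behind the case `n' = 3`: `6·C(ℓ,2) + 5ℓ + 1 ≤ 5·2^ℓ`. -/
theorem six_choose_two_le (ℓ : ℕ) : 6 * ℓ.choose 2 + 5 * ℓ + 1 ≤ 5 * 2 ^ ℓ := by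
  rcases lt_or_ge ℓ 2 with h | h
  · interval_cases ℓ <;> decide
  · induction ℓ, h using Nat.le_induction with
    | base => decide
    | succ n hn ih =>
      rw [choose_two_succ, pow_succ]
      have h4 : 4 ≤ 2 ^ n := by
        calc 4 = 2 ^ 2 := by norm_num
          _ ≤ 2 ^ n := Nat.pow_le_pow_right (by norm_num) hn
      have := two_mul_le_two_pow_add_one n
      omega

/-- The numeric inequality behind the case `n' = 2`: `2·C(ℓ,2) ≤ 2^ℓ + ℓ + 1`. -/
theorem two_choose_two_le (ℓ : ℕ) : 2 * ℓ.choose 2 ≤ 2 ^ ℓ + ℓ + 1 := by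
  induction ℓ with
  | zero => decide
  | succ n ih =>
    rw [choose_two_succ, pow_succ]
    have := two_mul_le_two_pow_add_one n
    omega

section Lines

variable {M : Matroid α} [M.Finite]

/-- The ground set as a finset. -/
noncomputable def gr (M : Matroid α) [M.Finite] : Finset α := M.ground_finite.toFinset

omit [DecidableEq α] in
/-- `↑(gr M) = M.E`. -/
theorem coe_gr (M : Matroid α) [M.Finite] : ((gr M : Finset α) : Set α) = M.E := M.ground_finite.coe_toFinset

/-- The closure of a finset, as a finset. -/
noncomputable def clF (M : Matroid α) [M.Finite] (B : Finset α) : Finset α :=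
  (M.ground_finite.subset (M.closure_subset_ground (B : Set α))).toFinset

omit [DecidableEq α] in
/-- `↑(clF M B) = M.closure ↑B`. -/
theorem coe_clF (M : Matroid α) [M.Finite] (B : Finset α) :
    ((clF M B : Finset α) : Set α) = M.closure (B : Set α) := Set.Finite.coe_toFinset _

open scoped Classical in
/-- The lines of `M`: the rank-2 flats, as finsets of the ground set. -/
noncomputable def lines (M : Matroid α) [M.Finite] : Finset (Finset α) :=
  (gr M).powerset.filter (fun L => M.IsFlat (L : Set α) ∧ M.eRk (L : Set α) = 2)

open scoped Classical in
omit [DecidableEq α] in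
/-- Membership in `lines`. -/
theorem mem_lines {L : Finset α} :
    L ∈ lines M ↔ L ⊆ gr M ∧ M.IsFlat (L : Set α) ∧ M.eRk (L : Set α) = 2 := by
  simp [lines]

omit [DecidableEq α] in
/-- A subset of a line of rank `2` has the line as its closure. -/
theorem closure_eq_of_subset_line {L B : Finset α} (hL : L ∈ lines M) (hB : B ⊆ L)
    (hr : M.eRk (B : Set α) = 2) : M.closure (B : Set α) = (L : Set α) := by
  rw [mem_lines] at hL
  obtain ⟨hLE, hLflat, hLr⟩ := hL
  have hLE' : (L : Set α) ⊆ M.E := by rw [← coe_gr M]; exact_mod_cast hLE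
  have hBE : (B : Set α) ⊆ M.E := (Finset.coe_subset.2 hB).trans hLE'
  obtain ⟨I, hI⟩ := M.exists_isBasis (B : Set α) hBE
  have hIL : I ⊆ (L : Set α) := hI.subset.trans (Finset.coe_subset.2 hB)
  have hIr : M.eRk (L : Set α) ≤ M.eRk I := by
    rw [hLr, hI.indep.eRk_eq_encard, hI.encard_eq_eRk, hr]
  have hIL' : M.IsBasis I (L : Set α) :=
    hI.indep.isBasis_of_eRk_ge (B.finite_toSet.subset hI.subset) hIL hIr hLE'
  rw [← hI.closure_eq_closure, hIL'.closure_eq_closure, hLflat.closure]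

omit [DecidableEq α] in
/-- In a simple matroid a set with two distinct points has rank at least `2`. -/
theorem two_le_eRk_of_two_mem (hs : Simple M) {B : Finset α} (hB : B ⊆ gr M) {a b : α} (ha : a ∈ B)
    (hb : b ∈ B) (hab : a ≠ b) : (2 : ℕ∞) ≤ M.eRk (B : Set α) := by
  have hBE : (B : Set α) ⊆ M.E := by rw [← coe_gr M]; exact_mod_cast hB
  have h := hs a (hBE ha) b (hBE hb) hab
  rw [← h]
  exact M.eRk_mono (by
    intro x hx
    simp only [Set.mem_insert_iff, Set.mem_singleton_iff] at hx
    rcases hx with rfl | rfl <;> simpa)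

omit [DecidableEq α] in
/-- A subset of a line with at least two points has rank exactly `2`. -/
theorem eRk_eq_two_of_subset_line (hs : Simple M) {L B : Finset α} (hL : L ∈ lines M) (hB : B ⊆ L)
    (hcard : 2 ≤ B.card) : M.eRk (B : Set α) = 2 := by
  have hL' := (mem_lines.1 hL)
  obtain ⟨a, ha, b, hb, hab⟩ := Finset.one_lt_card.1 hcard
  apply le_antisymm
  · calc M.eRk (B : Set α) ≤ M.eRk (L : Set α) := M.eRk_mono (Finset.coe_subset.2 hB)
      _ = 2 := hL'.2.2
  · exact two_le_eRk_of_two_mem hs (hB.trans hL'.1) ha hb hab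

/-- Two lines sharing two distinct points coincide. -/
theorem lines_eq_of_two_mem (hs : Simple M) {L L' : Finset α} (hL : L ∈ lines M) (hL' : L' ∈ lines M)
    {a b : α} (haL : a ∈ L) (hbL : b ∈ L) (haL' : a ∈ L') (hbL' : b ∈ L') (hab : a ≠ b) : L = L' := by
  have hsub : ({a, b} : Finset α) ⊆ L := by
    intro x hx
    simp only [Finset.mem_insert, Finset.mem_singleton] at hx
    rcases hx with rfl | rfl <;> assumption
  have hsub' : ({a, b} : Finset α) ⊆ L' := by
    intro x hx
    simp only [Finset.mem_insert, Finset.mem_singleton] at hx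
    rcases hx with rfl | rfl <;> assumption
  have hc : 2 ≤ ({a, b} : Finset α).card := by rw [Finset.card_pair hab]
  have h1 := closure_eq_of_subset_line hL hsub (eRk_eq_two_of_subset_line hs hL hsub hc)
  have h2 := closure_eq_of_subset_line hL' hsub' (eRk_eq_two_of_subset_line hs hL' hsub' hc)
  exact Finset.coe_injective (h1.symm.trans h2)

/-- Adding a point off a line to a rank-2 subset of the line gives rank `3`. -/
theorem eRk_insert_eq_three (hs : Simple M) {L B : Finset α} (hL : L ∈ lines M) (hB : B ⊆ L)
    (hcard : 2 ≤ B.card) {x : α} (hx : x ∈ gr M) (hxL : x ∉ L) :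
    M.eRk ((insert x B : Finset α) : Set α) = 3 := by
  have hr := eRk_eq_two_of_subset_line hs hL hB hcard
  have hcl := closure_eq_of_subset_line hL hB hr
  have hxE : x ∈ M.E := by rw [← coe_gr M]; exact_mod_cast hx
  have hx' : x ∈ M.E \ M.closure (B : Set α) := by
    rw [hcl]; exact ⟨hxE, by exact_mod_cast hxL⟩
  rw [Finset.coe_insert, Matroid.eRk_insert_eq_add_one hx', hr]
  rfl

omit [DecidableEq α] in
/-- The closure of a rank-2 subset of the ground set is a line containing it. -/
theorem clF_mem_lines {B : Finset α} (hB : B ⊆ gr M) (hr : M.eRk (B : Set α) = 2) :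
    clF M B ∈ lines M ∧ B ⊆ clF M B := by
  have hBE : (B : Set α) ⊆ M.E := by rw [← coe_gr M]; exact_mod_cast hB
  refine ⟨?_, ?_⟩
  · rw [mem_lines, coe_clF]
    refine ⟨?_, M.isFlat_closure _, by rw [M.eRk_closure_eq, hr]⟩
    rw [← Finset.coe_subset, coe_clF, coe_gr]
    exact M.closure_subset_ground _
  · rw [← Finset.coe_subset, coe_clF]
    exact M.subset_closure _ hBE

end Lines

end ThmH

end PercRepro
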